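import Mathlib
import HarnessLib

/-!
# Picard–Lindelöf for damped lattice systems `ẋ_j = f_j(x) − c_j x_j` with unbounded damping rates

Trunk: analysis / ODE.  For an infinite system of scalar ODEs indexed by a discrete set `ι`,
`ẋ_j(t) = f(x(t))_j − c_j x_j(t)` with ARBITRARY non-negative damping rates `c_j ≥ 0` (no bound in
`j`) and a nonlinearity `f : (ι →ᵇ ℝ) → (ι →ᵇ ℝ)` that is Lipschitz and bounded on a ball of the
sup-norm space and continuous along componentwise-continuous bounded curves (finite-range fields, e.g.
nearest-neighbour lattices), we prove LOCAL EXISTENCE by the Picard contraction applied to the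
variation-of-constants (Duhamel) form `x_j(t) = e^{-c_j t}x_j(0) + ∫₀ᵗ e^{-c_j(t-s)} f(x(s))_j ds`
(Teschl 2012, Thm. 2.2, with the linear part integrated exactly as in §3.4 (3.97)): the existence
window depends only on the Lipschitz and sup bounds of `f`, NOT on the damping, because
`0 ≤ e^{-c_j(t-s)} ≤ 1`.  The solution is produced as a curve `𝓤 : ℝ → (ι →ᵇ ℝ)` whose COMPONENTS are
continuously differentiable (the curve itself need not be continuous in the sup norm — the damping
semigroup is not strongly continuous on `ℓ^∞`-type spaces), together with: invariance of a frozen set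
of indices, gluing/continuation under an a priori bound (Teschl 2012, Cor. 2.16) and global existence
on `[0, ∞)`.  Used for the NS-scaled viscous cascade lattices of Tao 2016 §4
(`Literature/Analysis/FluidPDE/Tao2016AveragedNS/ViscousLatticeFlows.lean`).

## References
* G. Teschl, *Ordinary Differential Equations and Dynamical Systems*, GSM 140 (AMS 2012), Thm. 2.2
  (Picard–Lindelöf), §3.4 (3.97) (variation of constants), Cor. 2.16 (continuation). [Teschl2012]
-/

noncomputable section

open Set Metric Filter Topology BoundedContinuousFunction

open scoped NNReal

namespace Literature.Analysis.ODE

variable {ι : Type*} [TopologicalSpace ι] [DiscreteTopology ι]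

/-! ## Local existence (Duhamel–Picard), window independent of the damping -/

/-- **Local existence for damped lattice systems, window independent of the damping.**  Let
`f : (ι →ᵇ ℝ) → (ι →ᵇ ℝ)` be componentwise `K`-Lipschitz and bounded by `L` on the ball `‖U‖ ≤ R`, and
continuous along every componentwise-continuous curve in that ball; let `c_j ≥ 0` be ARBITRARY damping
rates and `J ⊆ ι` a set of indices frozen by `f` (`U|_J = 0 ⇒ f(U)|_J = 0`).  If `‖x₀‖ + δL ≤ R`,
`Kδ < 1` and `x₀|_J = 0`, there is a curve `𝓤 : ℝ → (ι →ᵇ ℝ)` with `𝓤 0 = x₀`, `‖𝓤 t‖ ≤ R`,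
`𝓤 t|_J = 0`, continuous components, and `d/dt 𝓤_j = f(𝓤)_j − c_j 𝓤_j` on `[0, δ]` (one-sided at the
ends) for every `j`.  Picard contraction for the variation-of-constants form; `e^{-c_j(t-s)} ≤ 1` makes
every estimate damping-free. [cite: Teschl2012, Thm. 2.2 and §3.4 (3.97)] -/
theorem exists_dampedFlow_short (f : (ι →ᵇ ℝ) → (ι →ᵇ ℝ)) (c : ι → ℝ) (hc : ∀ j, 0 ≤ c j)
    (J : Set ι) (hJ : ∀ U : ι →ᵇ ℝ, (∀ j ∈ J, U j = 0) → ∀ j ∈ J, f U j = 0)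
    {R K L δ : ℝ} (hK : 0 ≤ K) (hL : 0 ≤ L) (hδ : 0 < δ)
    (hlip : ∀ U V : ι →ᵇ ℝ, ‖U‖ ≤ R → ‖V‖ ≤ R → ∀ j, |f U j - f V j| ≤ K * ‖U - V‖)
    (hbdd : ∀ U : ι →ᵇ ℝ, ‖U‖ ≤ R → ∀ j, |f U j| ≤ L)
    (hcont : ∀ 𝓥 : ℝ → (ι →ᵇ ℝ), (∀ t, ‖𝓥 t‖ ≤ R) → (∀ j, Continuous fun t => 𝓥 t j) →
      ∀ j, Continuous fun t => f (𝓥 t) j)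
    (x₀ : ι →ᵇ ℝ) (hx₀ : ‖x₀‖ + δ * L ≤ R) (hKδ : K * δ < 1) (hx₀J : ∀ j ∈ J, x₀ j = 0) :
    ∃ 𝓤 : ℝ → (ι →ᵇ ℝ), 𝓤 0 = x₀ ∧ (∀ t, ‖𝓤 t‖ ≤ R) ∧ (∀ t, ∀ j ∈ J, 𝓤 t j = 0) ∧
      (∀ j, Continuous fun t => 𝓤 t j) ∧
      ∀ j, ∀ t ∈ Icc 0 δ,
        HasDerivWithinAt (fun s => 𝓤 s j) (f (𝓤 t) j - c j * 𝓤 t j) (Icc 0 δ) t := by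
  have hR : 0 ≤ R := le_trans (by positivity) hx₀
  -- time slices of a bounded family on `ι × ℝ`
  let slice : (ι × ℝ →ᵇ ℝ) → ℝ → (ι →ᵇ ℝ) := fun u s =>
    ofNormedAddCommGroupDiscrete (fun j => u (j, s)) ‖u‖ fun j => u.norm_coe_le_norm (j, s)
  have slice_apply : ∀ (u : ι × ℝ →ᵇ ℝ) (s : ℝ) (j : ι), slice u s j = u (j, s) := fun _ _ _ => rfl
  have norm_slice_le : ∀ (u : ι × ℝ →ᵇ ℝ) (s : ℝ), ‖slice u s‖ ≤ ‖u‖ := fun u s =>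
    (norm_le (norm_nonneg _)).2 fun j => u.norm_coe_le_norm (j, s)
  have norm_slice_sub_le : ∀ (u v : ι × ℝ →ᵇ ℝ) (s : ℝ), ‖slice u s - slice v s‖ ≤ ‖u - v‖ :=
    fun u v s => (norm_le (norm_nonneg _)).2 fun j => by
      simpa [slice_apply] using (u - v).norm_coe_le_norm (j, s)
  -- the clamp onto `[0, δ]`
  set κ : ℝ → ℝ := fun t => max 0 (min δ t) with hκ
  have hκc : Continuous κ := continuous_const.max (continuous_const.min continuous_id)
  have hκ0 : ∀ t, 0 ≤ κ t := fun t => le_max_left _ _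
  have hκδ : ∀ t, κ t ≤ δ := fun t => max_le hδ.le (min_le_left _ _)
  have hκid : ∀ t ∈ Icc 0 δ, κ t = t := fun t ht => by
    rw [hκ]; simp only; rw [min_eq_right ht.2, max_eq_right ht.1]
  -- the space and the ball
  set S : Set (ι × ℝ →ᵇ ℝ) := {u | ‖u‖ ≤ R ∧ ∀ j ∈ J, ∀ t, u (j, t) = 0} with hS
  -- the integrand along a family `u`
  set g : (ι × ℝ →ᵇ ℝ) → ι → ℝ → ℝ := fun u j s => f (slice u s) j with hg
  have hgc : ∀ u : ι × ℝ →ᵇ ℝ, ‖u‖ ≤ R → ∀ j, Continuous (g u j) := by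
    intro u hu j
    exact hcont (fun s => slice u s) (fun s => (norm_slice_le u s).trans hu)
      (fun j => (u.continuous.comp (Continuous.prodMk_right j))) j
  have hgb : ∀ u : ι × ℝ →ᵇ ℝ, ‖u‖ ≤ R → ∀ j s, |g u j s| ≤ L := fun u hu j s =>
    hbdd _ ((norm_slice_le u s).trans hu) j
  have hgl : ∀ u v : ι × ℝ →ᵇ ℝ, ‖u‖ ≤ R → ‖v‖ ≤ R → ∀ j s, |g u j s - g v j s| ≤ K * ‖u - v‖ :=
    fun u v hu hv j s => (hlip _ _ ((norm_slice_le u s).trans hu) ((norm_slice_le v s).trans hv) j).trans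
      (mul_le_mul_of_nonneg_left (norm_slice_sub_le u v s) hK)
  -- the Duhamel formula
  set φ : (ι × ℝ →ᵇ ℝ) → ι → ℝ → ℝ := fun u j t =>
    Real.exp (-(c j * κ t)) * (x₀ j + ∫ s in (0 : ℝ)..κ t, Real.exp (c j * s) * g u j s) with hφ
  have φ_def : ∀ u j t, φ u j t =
      Real.exp (-(c j * κ t)) * (x₀ j + ∫ s in (0 : ℝ)..κ t, Real.exp (c j * s) * g u j s) :=
    fun _ _ _ => rfl
  have g_def : ∀ u j s, g u j s = f (slice u s) j := fun _ _ _ => rfl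
  -- basic estimate of the damped integral
  have hint : ∀ (j : ι) (h : ℝ → ℝ) (M τ : ℝ), 0 ≤ τ → (∀ s, |h s| ≤ M) →
      |Real.exp (-(c j * τ)) * ∫ s in (0 : ℝ)..τ, Real.exp (c j * s) * h s| ≤ τ * M := by
    intro j h M τ hτ hM
    have hM0 : 0 ≤ M := (abs_nonneg _).trans (hM 0)
    have h1 : ‖∫ s in (0 : ℝ)..τ, Real.exp (c j * s) * h s‖ ≤ Real.exp (c j * τ) * M * |τ - 0| := by
      refine intervalIntegral.norm_integral_le_of_norm_le_const fun s hs => ?_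
      rw [uIoc_of_le hτ] at hs
      rw [Real.norm_eq_abs, abs_mul, abs_of_pos (Real.exp_pos _)]
      exact mul_le_mul (Real.exp_le_exp.2 (mul_le_mul_of_nonneg_left hs.2 (hc j))) (hM s)
        (abs_nonneg _) (Real.exp_pos _).le
    rw [sub_zero, abs_of_nonneg hτ, Real.norm_eq_abs] at h1
    rw [abs_mul, abs_of_pos (Real.exp_pos _)]
    calc Real.exp (-(c j * τ)) * |∫ s in (0 : ℝ)..τ, Real.exp (c j * s) * h s|
        ≤ Real.exp (-(c j * τ)) * (Real.exp (c j * τ) * M * τ) :=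
          mul_le_mul_of_nonneg_left h1 (Real.exp_pos _).le
      _ = τ * M := by
          rw [← mul_assoc, ← mul_assoc, ← Real.exp_add, neg_add_cancel, Real.exp_zero, one_mul,
            mul_comm]
  -- `φ u` is continuous in `t` for each `j`
  have hφc : ∀ u : ι × ℝ →ᵇ ℝ, ‖u‖ ≤ R → ∀ j, Continuous (φ u j) := by
    intro u hu j
    have h1 : Continuous fun τ => ∫ s in (0 : ℝ)..τ, Real.exp (c j * s) * g u j s :=
      intervalIntegral.continuous_primitive
        (fun a b => ((Real.continuous_exp.comp (continuous_const.mul continuous_id)).mul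
          (hgc u hu j)).intervalIntegrable a b) 0
    exact ((Real.continuous_exp.comp ((continuous_const.mul hκc).neg)).mul
      (continuous_const.add (h1.comp hκc)))
  -- `φ u` is bounded by `R`
  have hφb : ∀ u : ι × ℝ →ᵇ ℝ, ‖u‖ ≤ R → ∀ j t, |φ u j t| ≤ R := by
    intro u hu j t
    have h1 := hint j (g u j) L (κ t) (hκ0 t) (hgb u hu j)
    have h2 : |Real.exp (-(c j * κ t)) * x₀ j| ≤ ‖x₀‖ := by
      rw [abs_mul, abs_of_pos (Real.exp_pos _)]
      have hx : |x₀ j| ≤ ‖x₀‖ := by simpa using x₀.norm_coe_le_norm j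
      have he : Real.exp (-(c j * κ t)) ≤ 1 :=
        Real.exp_le_one_iff.2 (neg_nonpos.2 (mul_nonneg (hc j) (hκ0 t)))
      nlinarith [abs_nonneg (x₀ j), Real.exp_pos (-(c j * κ t))]
    simp only [hφ, mul_add]
    calc |Real.exp (-(c j * κ t)) * x₀ j +
          Real.exp (-(c j * κ t)) * ∫ s in (0 : ℝ)..κ t, Real.exp (c j * s) * g u j s|
        ≤ ‖x₀‖ + κ t * L := (abs_add_le _ _).trans (add_le_add h2 h1)
      _ ≤ ‖x₀‖ + δ * L := by nlinarith [hκδ t]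
      _ ≤ R := hx₀
  -- the Picard map
  have hΦmem : ∀ u : ι × ℝ →ᵇ ℝ, ‖u‖ ≤ R →
      ∃ Φu : ι × ℝ →ᵇ ℝ, (∀ j t, Φu (j, t) = φ u j t) := by
    intro u hu
    refine ⟨ofNormedAddCommGroup (fun p : ι × ℝ => φ u p.1 p.2) ?_ R (fun p => ?_), fun j t => rfl⟩
    · exact continuous_prod_of_discrete_left.2 fun j => hφc u hu j
    · rw [Real.norm_eq_abs]; exact hφb u hu p.1 p.2
  classical
  set Φ : (ι × ℝ →ᵇ ℝ) → (ι × ℝ →ᵇ ℝ) := fun u =>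
    if hu : ‖u‖ ≤ R then (hΦmem u hu).choose else u with hΦ
  have hΦapp : ∀ u : ι × ℝ →ᵇ ℝ, ‖u‖ ≤ R → ∀ j t, Φ u (j, t) = φ u j t := by
    intro u hu j t
    simp only [hΦ, dif_pos hu]
    exact (hΦmem u hu).choose_spec j t
  -- `Φ` maps the constraint set into itself
  have hmaps : MapsTo Φ S S := by
    intro u hu
    refine ⟨(norm_le hR).2 fun p => ?_, fun j hj t => ?_⟩
    · rw [hΦapp u hu.1, Real.norm_eq_abs]; exact hφb u hu.1 p.1 p.2
    · rw [hΦapp u hu.1]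
      have hz : ∀ s, g u j s = 0 := fun s =>
        hJ (slice u s) (fun i hi => by rw [slice_apply]; exact hu.2 i hi s) j hj
      simp [hφ, hz, hx₀J j hj]
  -- `Φ` is a contraction on `S`
  have hcontr : ∀ u v : ι × ℝ →ᵇ ℝ, u ∈ S → v ∈ S → dist (Φ u) (Φ v) ≤ (K * δ) * dist u v := by
    intro u v hu hv
    rw [dist_eq_norm, dist_eq_norm]
    refine (norm_le (by positivity)).2 fun p => ?_
    obtain ⟨j, t⟩ := p
    rw [BoundedContinuousFunction.coe_sub, Pi.sub_apply, hΦapp u hu.1, hΦapp v hv.1, Real.norm_eq_abs]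
    have hdiff : φ u j t - φ v j t = Real.exp (-(c j * κ t)) *
        ∫ s in (0 : ℝ)..κ t, Real.exp (c j * s) * (g u j s - g v j s) := by
      rw [φ_def, φ_def]
      have hi : ∀ w : ι × ℝ →ᵇ ℝ, ‖w‖ ≤ R →
          IntervalIntegrable (fun s => Real.exp (c j * s) * g w j s) MeasureTheory.volume 0 (κ t) :=
        fun w hw => ((Real.continuous_exp.comp (continuous_const.mul continuous_id)).mul
          (hgc w hw j)).intervalIntegrable _ _
      rw [← mul_sub, add_sub_add_left_eq_sub, ← intervalIntegral.integral_sub (hi u hu.1) (hi v hv.1)]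
      congr 1
      refine intervalIntegral.integral_congr fun s _ => ?_
      ring
    rw [hdiff]
    refine (hint j _ (K * ‖u - v‖) (κ t) (hκ0 t) fun s => hgl u v hu.1 hv.1 j s).trans ?_
    calc κ t * (K * ‖u - v‖) ≤ δ * (K * ‖u - v‖) :=
          mul_le_mul_of_nonneg_right (hκδ t) (by positivity)
      _ = K * δ * ‖u - v‖ := by ring
  -- Banach fixed point on the complete set `S`
  have hSclosed : IsClosed S := by
    have h1 : IsClosed {u : ι × ℝ →ᵇ ℝ | ‖u‖ ≤ R} := isClosed_le continuous_norm continuous_const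
    have h2 : IsClosed {u : ι × ℝ →ᵇ ℝ | ∀ j ∈ J, ∀ t, u (j, t) = 0} := by
      have : {u : ι × ℝ →ᵇ ℝ | ∀ j ∈ J, ∀ t, u (j, t) = 0} =
          ⋂ j ∈ J, ⋂ t : ℝ, {u : ι × ℝ →ᵇ ℝ | u (j, t) = 0} := by
        ext u; simp
      rw [this]
      exact isClosed_biInter fun j _ => isClosed_iInter fun t =>
        isClosed_eq ((BoundedContinuousFunction.evalCLM ℝ (j, t)).continuous) continuous_const
    simpa [hS, Set.setOf_and] using h1.inter h2
  set u₀ : ι × ℝ →ᵇ ℝ := ofNormedAddCommGroup (fun p : ι × ℝ => x₀ p.1)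
    (continuous_prod_of_discrete_left.2 fun j => by
      simpa using (continuous_const : Continuous fun _ : ℝ => x₀ j)) ‖x₀‖
    (fun p => x₀.norm_coe_le_norm p.1) with hu₀
  have hu₀S : u₀ ∈ S := by
    refine ⟨(norm_le hR).2 fun p => (x₀.norm_coe_le_norm p.1).trans ?_, fun j hj t => hx₀J j hj⟩
    linarith [mul_nonneg hδ.le hL]
  have hKδ0 : 0 ≤ K * δ := by positivity
  set Kn : ℝ≥0 := ⟨K * δ, hKδ0⟩ with hKn
  have hcw : ContractingWith Kn (hmaps.restrict Φ S S) := by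
    refine ⟨by exact_mod_cast hKδ, LipschitzWith.of_dist_le_mul fun u v => ?_⟩
    show dist (Φ u) (Φ v) ≤ (K * δ) * dist (u : ι × ℝ →ᵇ ℝ) v
    exact hcontr u v u.2 v.2
  obtain ⟨u, huS, hfix, -⟩ := hcw.exists_fixedPoint' hSclosed.isComplete hmaps hu₀S (edist_ne_top _ _)
  have hu : ‖u‖ ≤ R := huS.1
  have hueq : ∀ j t, u (j, t) = φ u j t := fun j t => by
    have := congrArg (fun w : ι × ℝ →ᵇ ℝ => w (j, t)) hfix
    simpa [hΦapp u hu] using this.symm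
  -- the solution curve
  refine ⟨fun t => slice u t, ?_, fun t => (norm_slice_le u t).trans hu,
    fun t j hj => by rw [slice_apply]; exact huS.2 j hj t,
    fun j => u.continuous.comp (Continuous.prodMk_right j), fun j t ht => ?_⟩
  · ext j
    rw [slice_apply, hueq]
    simp [hφ, hκ, hδ.le]
  · -- the derivative on `[0, δ]`
    have hgj : Continuous (g u j) := hgc u hu j
    have hI : Continuous fun s => Real.exp (c j * s) * g u j s :=
      (Real.continuous_exp.comp (continuous_const.mul continuous_id)).mul hgj
    have hψd : ∀ τ, HasDerivAt
        (fun τ => Real.exp (-(c j * τ)) * (x₀ j + ∫ s in (0 : ℝ)..τ, Real.exp (c j * s) * g u j s))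
        (Real.exp (-(c j * τ)) * (-(c j)) *
            (x₀ j + ∫ s in (0 : ℝ)..τ, Real.exp (c j * s) * g u j s) +
          Real.exp (-(c j * τ)) * (Real.exp (c j * τ) * g u j τ)) τ := by
      intro τ
      have h1 : HasDerivAt (fun τ => Real.exp (-(c j * τ))) (Real.exp (-(c j * τ)) * (-(c j))) τ := by
        have := ((hasDerivAt_id τ).const_mul (c j)).neg.exp
        simpa using this
      have h2 : HasDerivAt (fun τ => x₀ j + ∫ s in (0 : ℝ)..τ, Real.exp (c j * s) * g u j s)
          (Real.exp (c j * τ) * g u j τ) τ := by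
        simpa using (hI.integral_hasStrictDerivAt 0 τ).hasDerivAt.const_add (x₀ j)
      exact h1.mul h2
    have heq : EqOn (fun s => slice u s j)
        (fun τ => Real.exp (-(c j * τ)) * (x₀ j + ∫ s in (0 : ℝ)..τ, Real.exp (c j * s) * g u j s))
        (Icc 0 δ) := fun s hs => by
      show slice u s j = _
      rw [slice_apply, hueq, φ_def, hκid s hs]
    have hval : Real.exp (-(c j * t)) * (-(c j)) *
          (x₀ j + ∫ s in (0 : ℝ)..t, Real.exp (c j * s) * g u j s) +
        Real.exp (-(c j * t)) * (Real.exp (c j * t) * g u j t) =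
        f (slice u t) j - c j * slice u t j := by
      rw [slice_apply, hueq, φ_def, hκid t ht, g_def, ← mul_assoc (Real.exp (-(c j * t))),
        ← Real.exp_add, neg_add_cancel, Real.exp_zero, one_mul]
      ring
    rw [← hval]
    exact ((hψd t).hasDerivWithinAt).congr heq (heq ht)

end Literature.Analysis.ODE

end
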